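import Summits.Ventures.YMGap.FlowData.RectTubePolyakovLine
import Summits.Ventures.YMGap.FlowData.RectTubeFluxGap
import Summits.Ventures.YMGap.FlowData.TubeFluxNonAnnihilation
import HarnessLib

/-!
# Venture YMGap, track Y3 FLOW-DATA (v2, rectangular cross-sections) — NO AXIAL FLUX SECTOR OF THE RECTANGULAR TUBE
# TRANSFER OPERATOR IS ANNIHILATED: `0 < ‖T ∘ P_{ê_μ}‖`, hence `E₁ > 0` HYPOTHESIS-FREE on every `L₁ × ⋯ × L_k` tube of
# the `SU(2)` theory at every `β ≠ 0` (theorems only)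

HONEST FRAMING: venture file of the cell `pub-ymgap` (QuantumFields programme), track Y3; the rectangular twin of
`FlowData/TubeFluxNonAnnihilation.lean` for the v2 objects (`rectTubeTransferOperator`, `rectTubeSectorNorm`,
`su2RectTorelonEnergy`; the table's `2×3`, `2×4` tubes).  `RectTubeFluxGap.su2RectTorelonEnergy_pos` proves `E₁ > 0`
PROVIDED the sector along the axis is not annihilated; this file discharges the proviso with the same Polyakov-line
witness (`ψ(b) = e^{−J mag(b)/2} Re tr ρ(∏ₜ b(t ê_μ, μ))`, `t < Ls μ`): `rectTubeFluxProjection_apply_of_twist_eigen`,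
`inner_rectTubeTransferOperator_pathState` (`⟪ψ, Tψ⟫ = c₀^{N−m} λ^m ∫ W²`), **`rectTubeSectorNorm_pos_of_pathState`**,
**`su2_rectTubeSectorNorm_single_pos`** (`0 < su2RectSectorTop β Ls μ`, `β ≠ 0`) and the hypothesis-free
**`su2RectTorelonEnergy_pos'`**.  Finite rectangular torus; no number, no row, nothing about limits or a mass gap.

References: G. 't Hooft, Nucl. Phys. B 153 (1979) 141 [cite: tHooft1979Flux]; I. Montvay, G. Münster (1994) §3.2.6
[cite: MontvayMunster1994, §3.2.6]; M. Reed, B. Simon IV (1978) §XIII.12 [cite: ReedSimonIV1978, §XIII.12].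
-/

noncomputable section

open scoped BigOperators ENNReal
open MeasureTheory Filter Function
open Literature.MathematicalPhysics.QuantumFieldTheory Literature.Analysis.OperatorTheory
open Literature.MathematicalPhysics.QuantumLattice (RectTorusSite)

namespace Summit.Ventures.YMGap.FlowData

/-! ### Twist eigenfunctions lie in their flux sector (rectangular slice) -/

section Sector

variable {G : Type*} [Group G] [TopologicalSpace G] [IsTopologicalGroup G] [CompactSpace G]
  [MeasurableSpace G] [BorelSpace G] {k : ℕ} {Ls : Fin k → ℕ} [∀ i, NeZero (Ls i)] (z : G)

/-- A joint twist eigenfunction with eigenvalues `χ_e(s)` is fixed by `P_e` (rectangular slice). [cite: tHooft1979Flux] -/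
theorem rectTubeFluxProjection_apply_of_twist_eigen {e : Fin k → ZMod 2} {ψ : Lp ℝ 2 (rectSliceMeasure G Ls)}
    (hψ : ∀ s : Fin k → ZMod 2, rectFluxTwistOp Ls z s ψ = fluxSign e s • ψ) :
    rectTubeFluxProjection z Ls e ψ = ψ := by
  unfold rectTubeFluxProjection fluxProjection
  rw [_root_.smul_apply, _root_.sum_apply]
  simp_rw [_root_.smul_apply, hψ, smul_smul, fluxSign_mul_self, one_smul, Finset.sum_const, Finset.card_univ,
    Fintype.card_fun, ZMod.card, Fintype.card_fin]
  rw [← Nat.cast_smul_eq_nsmul ℝ, smul_smul]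
  have h2k : (2 : ℝ) ^ k ≠ 0 := by positivity
  rw [Nat.cast_pow, Nat.cast_ofNat, inv_mul_cancel₀ h2k, one_smul]

/-- The `L²` class of a pointwise twist eigenfunction is a twist eigenvector (rectangular slice). [folklore] -/
theorem rectFluxTwistOp_toLp_eq_smul (s : Fin k → ZMod 2) {f : RectSlice Ls G → ℝ}
    (hf : MemLp f 2 (rectSliceMeasure G Ls)) (χ : ℝ) (hfs : ∀ b, f (rectFluxTwist z s b) = χ * f b) :
    rectFluxTwistOp Ls z s (hf.toLp f) = χ • hf.toLp f := by
  apply Lp.ext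
  have h1 := rectFluxTwistOp_ae_eq (Ls := Ls) z s (hf.toLp f)
  have h2 : ((hf.toLp f : Lp ℝ 2 (rectSliceMeasure G Ls)) : RectSlice Ls G → ℝ) ∘ rectFluxTwist z s
      =ᵐ[rectSliceMeasure G Ls] f ∘ rectFluxTwist z s :=
    (measurePreserving_rectFluxTwist (Ls := Ls) z s).quasiMeasurePreserving.ae_eq_comp hf.coeFn_toLp
  have h3 : (f ∘ rectFluxTwist (Ls := Ls) z s) = fun b => χ * f b := funext fun b => hfs b
  filter_upwards [h1, h2, Lp.coeFn_smul χ (hf.toLp f), hf.coeFn_toLp] with b hb1 hb2 hb3 hb4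
  rw [hb1, hb2, h3, hb3, Pi.smul_apply, hb4, smul_eq_mul]

end Sector

/-! ### Holonomy-trace states on the rectangular slice and their image under the transfer operator -/

section PathState

variable {G : Type*} [Group G] [TopologicalSpace G] [IsTopologicalGroup G] [CompactSpace G]
  [MeasurableSpace G] [BorelSpace G] [SecondCountableTopology G] {n k : ℕ} (ρ : G →* Matrix (Fin n) (Fin n) ℂ)
  (J : ℝ) {Ls : Fin k → ℕ} [∀ i, NeZero (Ls i)]

/-- **`⟪ψ, T ψ⟫` for a holonomy-trace state on the rectangular slice**, `ψ(b) = e^{−J mag(b)/2} Re tr ρ(∏ₜ b(ℓ t))`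
with `ℓ` an injective link family whose trace is gauge invariant: `⟪ψ, Tψ⟫ = c₀^{N−m} λ^m ∫ W²`.
[cite: MontvayMunster1994, §3.2.6] -/
theorem inner_rectTubeTransferOperator_pathState (hρ : Continuous ρ) {lam : ℝ}
    (hM : ∀ i j, ∫ c, (Real.exp (J * (ρ c).trace.re) : ℂ) * ρ c i j ∂haarProbability G = if i = j then (lam : ℂ) else 0)
    {m : ℕ} (ℓ : Fin m → RectTorusSite Ls × Fin k) (hℓ : Injective ℓ)
    (hWg : ∀ (γ : RectTorusSite Ls → G) (b : RectSlice Ls G),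
      (ρ ((List.ofFn fun t : Fin m =>
        (fun e : RectTorusSite Ls × Fin k => γ e.1 * b e * (γ (e.1 + Pi.single e.2 1))⁻¹) (ℓ t)).prod)).trace.re =
        (ρ ((List.ofFn fun t : Fin m => b (ℓ t)).prod)).trace.re)
    (hmem : MemLp (fun b : RectSlice Ls G => Real.exp (-(J / 2 * rectMagSum (Ls := Ls) ρ b)) *
      (ρ ((List.ofFn fun t : Fin m => b (ℓ t)).prod)).trace.re) 2 (rectSliceMeasure G Ls)) :
    @inner ℝ _ _ (hmem.toLp _) (rectTubeTransferOperator ρ J Ls (hmem.toLp _)) =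
      (∫ g, Real.exp (J * (ρ g).trace.re) ∂haarProbability G) ^ (Fintype.card (RectTorusSite Ls × Fin k) - m) * lam ^ m *
        ∫ b, (ρ ((List.ofFn fun t : Fin m => b (ℓ t)).prod)).trace.re ^ 2 ∂(rectSliceMeasure G Ls) := by
  set W : RectSlice Ls G → ℝ := fun b => (ρ ((List.ofFn fun t : Fin m => b (ℓ t)).prod)).trace.re with hW
  set f : RectSlice Ls G → ℝ := fun b => Real.exp (-(J / 2 * rectMagSum (Ls := Ls) ρ b)) * W b with hf
  set C : ℝ := (∫ g, Real.exp (J * (ρ g).trace.re) ∂haarProbability G) ^ (Fintype.card (RectTorusSite Ls × Fin k) - m) *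
    lam ^ m with hC
  have hWc : Continuous W :=
    Complex.continuous_re.comp ((hρ.comp (continuous_prod_ofFn_apply m ℓ)).matrix_trace)
  have hWg' : ∀ (γ : RectTorusSite Ls → G) (b : RectSlice Ls G),
      W (fun e => γ e.1 * b e * (γ (e.1 + Pi.single e.2 1))⁻¹) = W b := fun γ b => hWg γ b
  -- Step 1: replace the `L²` representatives by the function `f`
  set ψ : Lp ℝ 2 (rectSliceMeasure G Ls) := hmem.toLp _ with hψ
  rw [inner_kernelOp_eq_integral (rectTubeTransferOperator_ae_eq J Ls hρ) ψ ψ]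
  have hae : (ψ : RectSlice Ls G → ℝ) =ᵐ[rectSliceMeasure G Ls] f := hmem.coeFn_toLp
  have h1 : ∀ a, ∫ b, rectSliceKernel (Ls := Ls) ρ J J a b * ψ b ∂(rectSliceMeasure G Ls) =
      ∫ b, rectSliceKernel (Ls := Ls) ρ J J a b * f b ∂(rectSliceMeasure G Ls) := by
    intro a
    refine integral_congr_ae ?_
    filter_upwards [hae] with b hb
    rw [hb]
  have h2 : (fun a => ψ a * ∫ b, rectSliceKernel (Ls := Ls) ρ J J a b * ψ b ∂(rectSliceMeasure G Ls))
      =ᵐ[rectSliceMeasure G Ls]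
      fun a => f a * ∫ b, rectSliceKernel (Ls := Ls) ρ J J a b * f b ∂(rectSliceMeasure G Ls) := by
    filter_upwards [hae] with a ha
    rw [ha, h1 a]
  rw [integral_congr_ae h2]
  -- Step 2: the inner integral
  have h3 : ∀ a, ∫ b, rectSliceKernel (Ls := Ls) ρ J J a b * f b ∂(rectSliceMeasure G Ls) =
      Real.exp (J / 2 * rectMagSum (Ls := Ls) ρ a) * (C * W a) := by
    intro a
    have hK : ∀ b, rectSliceKernel (Ls := Ls) ρ J J a b * f b = Real.exp (J / 2 * rectMagSum (Ls := Ls) ρ a) *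
        ((∫ E, Real.exp (J * rectElecSum (Ls := Ls) ρ a E b)
          ∂(Measure.pi fun _ : RectTorusSite Ls => haarProbability G)) * W b) := by
      intro b
      simp only [rectSliceKernel, hf, Real.exp_neg]
      field_simp
    simp_rw [hK]
    rw [integral_const_mul, integral_integral_exp_rectElecSum_mul ρ J hρ hWc hWg' a]
    congr 1
    have h4 : ∀ c : RectSlice Ls G, W (c * a) =
        ((1 : Matrix (Fin n) (Fin n) ℂ) * ρ ((List.ofFn fun t : Fin m => c (ℓ t) * a (ℓ t)).prod) * 1).trace.re := by
      intro c
      simp only [hW, Pi.mul_apply, one_mul, mul_one]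
    simp_rw [h4]
    have hw : Continuous fun g : G => Real.exp (J * (ρ g).trace.re) :=
      Real.continuous_exp.comp (continuous_const.mul (Complex.continuous_re.comp hρ.matrix_trace))
    rw [integral_prod_weight_mul_re_trace_rectLine ρ (w := fun g : G => Real.exp (J * (ρ g).trace.re)) hw hρ hM ℓ
      hℓ (fun t => a (ℓ t)) 1 1]
    simp only [hC, hW, one_mul, mul_one]
  simp_rw [h3]
  -- Step 3: the outer integral
  have h5 : ∀ a, f a * (Real.exp (J / 2 * rectMagSum (Ls := Ls) ρ a) * (C * W a)) = C * W a ^ 2 := by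
    intro a
    simp only [hf, Real.exp_neg]
    field_simp
  simp_rw [h5]
  rw [integral_const_mul]

/-- **A gauge-invariant holonomy-trace state with twist eigenvalues `χ_e(s)` witnesses the sector `e`**
(rectangular slice, general compact group): `0 < ‖T ∘ P_e‖`. [cite: tHooft1979Flux] -/
theorem rectTubeSectorNorm_pos_of_pathState (hρ : Continuous ρ) (hn : n ≠ 0) {z : G} (hz : z ∈ Subgroup.center G)
    {lam : ℝ} (hlam : lam ≠ 0)
    (hM : ∀ i j, ∫ c, (Real.exp (J * (ρ c).trace.re) : ℂ) * ρ c i j ∂haarProbability G = if i = j then (lam : ℂ) else 0)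
    {m : ℕ} (ℓ : Fin m → RectTorusSite Ls × Fin k) (hℓ : Injective ℓ) (e : Fin k → ZMod 2)
    (hWg : ∀ (γ : RectTorusSite Ls → G) (b : RectSlice Ls G),
      (ρ ((List.ofFn fun t : Fin m =>
        (fun e : RectTorusSite Ls × Fin k => γ e.1 * b e * (γ (e.1 + Pi.single e.2 1))⁻¹) (ℓ t)).prod)).trace.re =
        (ρ ((List.ofFn fun t : Fin m => b (ℓ t)).prod)).trace.re)
    (hWs : ∀ (s : Fin k → ZMod 2) (b : RectSlice Ls G),
      (ρ ((List.ofFn fun t : Fin m => rectFluxTwist z s b (ℓ t)).prod)).trace.re =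
        fluxSign e s * (ρ ((List.ofFn fun t : Fin m => b (ℓ t)).prod)).trace.re) :
    0 < rectTubeSectorNorm ρ z J Ls e := by
  set W : RectSlice Ls G → ℝ := fun b => (ρ ((List.ofFn fun t : Fin m => b (ℓ t)).prod)).trace.re with hW
  set f : RectSlice Ls G → ℝ := fun b => Real.exp (-(J / 2 * rectMagSum (Ls := Ls) ρ b)) * W b with hf
  have hWc : Continuous W :=
    Complex.continuous_re.comp ((hρ.comp (continuous_prod_ofFn_apply m ℓ)).matrix_trace)
  have hfc : Continuous f :=
    (Real.continuous_exp.comp (continuous_const.mul (continuous_rectMagSum (Ls := Ls) ρ hρ)).neg).mul hWc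
  obtain ⟨Cf, hCf⟩ := isCompact_univ.exists_bound_of_continuousOn hfc.continuousOn
  have hmem : MemLp f 2 (rectSliceMeasure G Ls) :=
    MemLp.of_bound hfc.aestronglyMeasurable Cf (Eventually.of_forall fun b => hCf b (Set.mem_univ _))
  have heig : ∀ s : Fin k → ZMod 2, rectFluxTwistOp Ls z s (hmem.toLp f) = fluxSign e s • hmem.toLp f := by
    intro s
    refine rectFluxTwistOp_toLp_eq_smul z s hmem _ fun b => ?_
    have hWs' : W (rectFluxTwist z s b) = fluxSign e s * W b := hWs s b
    simp only [hf]
    rw [rectMagSum_fluxTwist ρ hz, hWs']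
    ring
  have hP : rectTubeFluxProjection z Ls e (hmem.toLp f) = hmem.toLp f :=
    rectTubeFluxProjection_apply_of_twist_eigen z heig
  have hinner := inner_rectTubeTransferOperator_pathState ρ J hρ hM ℓ hℓ hWg hmem
  have hc0 : 0 < ∫ g, Real.exp (J * (ρ g).trace.re) ∂haarProbability G :=
    integral_exp_pos ((Real.continuous_exp.comp (continuous_const.mul
      (Complex.continuous_re.comp hρ.matrix_trace))).integrable_of_hasCompactSupport (HasCompactSupport.of_compactSpace _))
  have hW1 : W 1 = n := by
    have h : (List.ofFn fun t : Fin m => (1 : RectSlice Ls G) (ℓ t)).prod = 1 := by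
      simp only [Pi.one_apply, List.ofFn_const, List.prod_replicate, one_pow]
    simp only [hW, h, map_one, Matrix.trace_one, Fintype.card_fin, Complex.natCast_re]
  have hW2 : 0 < ∫ b, W b ^ 2 ∂(rectSliceMeasure G Ls) := by
    refine Continuous.integral_pos_of_hasCompactSupport_nonneg_nonzero (x := 1) (hWc.pow 2)
      (HasCompactSupport.of_compactSpace _) (fun b => sq_nonneg _) ?_
    rw [hW1]
    exact pow_ne_zero 2 (Nat.cast_ne_zero.2 hn)
  have hne : @inner ℝ _ _ (hmem.toLp f) (rectTubeTransferOperator ρ J Ls (hmem.toLp f)) ≠ 0 := by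
    rw [hinner]
    exact mul_ne_zero (mul_ne_zero (pow_ne_zero _ hc0.ne') (pow_ne_zero _ hlam)) hW2.ne'
  refine lt_of_le_of_ne (sectorNorm_nonneg _ _ _) fun h0 => hne ?_
  have hTP : (rectTubeTransferOperator ρ J Ls).comp (rectTubeFluxProjection z Ls e) = 0 := by
    have h := h0.symm
    unfold rectTubeSectorNorm sectorNorm at h
    exact norm_eq_zero.1 h
  have h := congrArg (fun A => A (hmem.toLp f)) hTP
  simp only [ContinuousLinearMap.comp_apply, hP, _root_.zero_apply] at h
  rw [h, inner_zero_right]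

omit [TopologicalSpace G] [IsTopologicalGroup G] [CompactSpace G] [MeasurableSpace G] [BorelSpace G]
  [SecondCountableTopology G] [∀ i, NeZero (Ls i)] in
/-- The straight line `t ↦ (t ê_μ, μ)`, `t < Ls μ`, of the rectangular torus consists of distinct links. [folklore] -/
theorem rectLine_injective (μ : Fin k) :
    Injective fun t : Fin (Ls μ) => ((Pi.single μ ((t : ℕ) : ZMod (Ls μ)), μ) : RectTorusSite Ls × Fin k) := by
  intro t t' h
  have h1 : ((t : ℕ) : ZMod (Ls μ)) = ((t' : ℕ) : ZMod (Ls μ)) := by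
    have := congrArg (fun e : RectTorusSite Ls × Fin k => e.1 μ) h
    simpa only [Pi.single_eq_same] using this
  rw [ZMod.natCast_eq_natCast_iff'] at h1
  rw [Nat.mod_eq_of_lt t.2, Nat.mod_eq_of_lt t'.2] at h1
  exact Fin.ext h1

/-- **No axial flux sector of the rectangular tube is annihilated** (general compact group): continuous `ρ` with
`ρ(z) = −1`, `z` central, non-zero Schur scalar ⇒ `0 < ‖T ∘ P_{ê_μ}‖`. [cite: tHooft1979Flux] -/
theorem rectTubeSectorNorm_single_pos_of_schurScalar (hρ : Continuous ρ) (hn : n ≠ 0) {z : G}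
    (hz : z ∈ Subgroup.center G) (hρz : ρ z = -1) {lam : ℝ} (hlam : lam ≠ 0)
    (hM : ∀ i j, ∫ c, (Real.exp (J * (ρ c).trace.re) : ℂ) * ρ c i j ∂haarProbability G = if i = j then (lam : ℂ) else 0)
    (μ : Fin k) : 0 < rectTubeSectorNorm ρ z J Ls (Pi.single μ 1) := by
  refine rectTubeSectorNorm_pos_of_pathState ρ J hρ hn hz hlam hM
    (fun t : Fin (Ls μ) => (Pi.single μ ((t : ℕ) : ZMod (Ls μ)), μ)) (rectLine_injective μ) (Pi.single μ 1)
    (fun γ b => ?_) (fun s b => ?_)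
  · rw [prod_ofFn_rectLine_gauge, map_mul, map_mul, Matrix.trace_mul_cycle, ← map_mul, inv_mul_cancel, map_one,
      one_mul]
  · rw [prod_ofFn_rectLine_fluxTwist, map_mul]
    have hsign : fluxSign (Pi.single μ 1 : Fin k → ZMod 2) s = if s μ = 1 then -1 else 1 := by
      unfold fluxSign
      rw [Finset.prod_eq_single μ]
      · simp only [Pi.single_eq_same, true_and]
      · intro ν _ hν
        simp only [Pi.single_apply, if_neg hν, zero_ne_one, false_and, if_false]
      · intro h; exact absurd (Finset.mem_univ μ) h
    rw [hsign]
    split_ifs with h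
    · rw [hρz, neg_mul, one_mul, Matrix.trace_neg, Complex.neg_re, neg_mul, one_mul]
    · rw [map_one, one_mul, one_mul]

end PathState

/-! ### The cell's object on rectangular cross-sections: `SU(2)`, `β ≠ 0` -/

section SU2

open Literature.MathematicalPhysics.QuantumLattice (fundamentalRep continuous_fundamentalRep secondCountableTopology_su2)

/-- **No axial flux sector of the rectangular `SU(2)` tube is annihilated**: `0 < su2RectSectorTop β Ls μ` for
every rectangular cross-section `Π_i ℤ/(Ls i)`, axis `μ` and `β ≠ 0` (the positivity conjunct of
`TubeStringTensionLawDim3Rect` at every point). [cite: tHooft1979Flux] -/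
theorem su2_rectTubeSectorNorm_single_pos {k : ℕ} {β : ℝ} (hβ : β ≠ 0) (Ls : Fin k → ℕ) [∀ i, NeZero (Ls i)]
    (μ : Fin k) : 0 < su2RectSectorTop β Ls μ := by
  haveI : SecondCountableTopology (Matrix.specialUnitaryGroup (Fin 2) ℂ) := secondCountableTopology_su2
  exact rectTubeSectorNorm_single_pos_of_schurScalar (fundamentalRep (Fin 2)) (β / 2) (continuous_fundamentalRep (Fin 2))
    two_ne_zero su2MinusOne_mem_center fundamentalRep_su2MinusOne (su2_schurScalar_ne_zero hβ)
    (su2_integral_exp_mul_apply (β / 2)) μ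

/-- **The cell's torelon energy on every rectangular cross-section is strictly positive, hypothesis-free**:
`0 < su2RectTorelonEnergy β Ls μ` (the table's `E1` / `E1_axis1` rows of the `2×3`, `2×4` tubes included) for every
`β ≠ 0`.  Finite volume only. [folklore] -/
theorem su2RectTorelonEnergy_pos' {k : ℕ} {β : ℝ} (hβ : β ≠ 0) (Ls : Fin k → ℕ) [∀ i, NeZero (Ls i)] (μ : Fin k) :
    0 < su2RectTorelonEnergy β Ls μ :=
  su2RectTorelonEnergy_pos β Ls μ (su2_rectTubeSectorNorm_single_pos hβ Ls μ)

end SU2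

end Summit.Ventures.YMGap.FlowData
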